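import Summits.AtomisticToContinuum.HydrodynamicLimit.Theorems.RelayRaceLocalityRestartPrincipleStubFiniteSize
import Summits.AtomisticToContinuum.HydrodynamicLimit.Theorems.RelayRaceLocalityRestartPrincipleStubSolutionShift
import Summits.AtomisticToContinuum.HydrodynamicLimit.Theorems.RelayRaceLocalityRestartPrincipleStubProbTransfer
import Summits.AtomisticToContinuum.HydrodynamicLimit.Theorems.RelayRaceLocalityRestartPrincipleStubRestartGlue
import Summits.AtomisticToContinuum.HydrodynamicLimit.Theorems.TwoClocksClampedWindowDockActivityInversion
import Summits.AtomisticToContinuum.HydrodynamicLimit.Theorems.TwoClocksClampedWindowDockReferenceLLN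
import HarnessLib

/-!
# Crux `RestartPrinciple` (stmt-AtomisticToContinuum-12503) — line `Sketch`, skeleton v7 (lead c2)

Route `RelayRaceLocality`, crux decl
`Summit.AtomisticToContinuum.HydrodynamicLimit.Theses.RelayRaceLocality.RestartPrinciple` `= (S → G)`:
`S` the short-time guarded hydrodynamic limit (prefix `∃ η₀ ∀ M ∃ τ₁ ∀ profile ∃ σ₀`), `G` the
packing-guarded conjunct (body of stmt-AtomisticToContinuum-9133 `GermanoSplitLES.HydroLimitInBand`,
moot copy stmt-3093).

Line `Sketch` (idea `glauber-laundering-restart`): at every restart time `s₀` replace ("launder") the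
TRUE law by the exact local Gibbs law of the time-`s₀` Euler profile, for forward macroscopic statistics,
and restart the short-time limit from that fresh local Gibbs gas; iterate along the classical solution.

State after cycle 3: EVERYTHING in the line that is known mathematics is PROVED (and landed: p108006
`Theorems/RelayRaceLocalityRestartPrincipleReduction.lean` = the restart induction
`restartPrinciple_of_restartableHL`; p108176 `Theorems/RelayRaceLocalityRestartPrincipleLineSketchRealisability.lean`
= `realisability` + `launderedRestart_of_forgetting`); this v7 keeps the same proofs IN-FILE so that it
elaborates before the farm has built the two new modules (v8 = the import form, two stubs + a one-line
composition, replaces it verbatim afterwards). Stubs — the two research bets, both OPEN and each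
hydrodynamic-limit-sized (jointly ≡ burden(`G`) = burden(stmt-9133): `RestartableHL ↔ G`, → p108006, ← p103746):
* `stub_restartableS` — BET 1: the short-time hydrodynamic limit for FRESH local Gibbs gases in the
  restartable prefix `∃ η₀ ∃ σ₀ ∀ σ < σ₀ ∀ M ∃ τ₁ ∀ profiles` (= the card's `RestartableS`);
* `stub_forgetting`   — FORGETTING: law-level forgetting at a restart time — any fresh local Gibbs gas
  realising the time-`s₀` Euler data reproduces the forward bounded-Lipschitz statistics of each
  empirical field of the true law on the window `w ≤ τ`, under the guards (= the card's
  `VelocityRefreshForgetting` + `CellRefreshForgetting` + `GlauberContraction` composed).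
Closed in-file (landed copies in parentheses): `integral_density_eq_one_of_lln`, `realisability` (p108176:
activity inversion `EntropyClockDock.exists_activity_of_density` + fixed-`σ` LLN
`EntropyClockDock.tie_rhoLim_of_smallDensity` — the static half of the card's laundering is known
mathematics), `launderedRestart_of_stubs` (= `launderedRestart_of_forgetting stub_forgetting`, p108176),
`restartableHL_of_stubs` (landed glue p101649 + p98797 + p100354), `guardedConjunct_of_stubs` (= restart
induction, p108006, with `stub_finiteSize` p96553), `RestartPrinciple_of` (the crux BY NAME; its antecedent `S`
is not consumed — prefix/anchoring defects, `Negative/RestartSchema.lean` p99454;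
`restartPrinciple_of_hydroLimitInBand`, p108006, closes the crux from stmt-9133 in one line).
Also landed from the superseded v6 phrasing of realisability (worker, p108307,
`Theorems/RelayRaceLocalityRestartPrincipleStubActivityInversion.lean`): `stub_activityInversion` — the
elementary pointwise inversion of the canonical cluster series `f_σ(y) = Σ_j clusterCoeff σ j · y^{j+1}` on
dilute targets (`g` continuous, positive, `g ≤ 2r ≤ 4g`, 2-Lipschitz in `r`); not needed by this composition.
-/

set_option linter.dupNamespace false

noncomputable section

open Literature.MathematicalPhysics.KineticTheory Literature.Analysis.FluidPDE
open Literature.Analysis.FunctionSpaces MeasureTheory Filter Set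
open Summit.AtomisticToContinuum.HydrodynamicLimit.Theses.RelayRaceLocality

namespace Summit.AtomisticToContinuum.HydrodynamicLimit.Theorems.RestartPrinciple

/-! ## Stubs -/

/-- STUB (BET 1; crux-sized): the short-time hydrodynamic limit for FRESH local Gibbs gases in the
restartable prefix — `η₀, σ₀` first, then the guard level `M`, then `τ₁`, uniformly in the profiles. -/
theorem stub_restartableS :
    ∃ η₀ : ℝ, 0 < η₀ ∧ ∃ σ₀ : ℝ, 0 < σ₀ ∧ ∀ σ : ℝ, 0 < σ → σ < σ₀ → ∀ M : ℝ, 0 < M →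
      ∃ τ₁ : ℝ, 0 < τ₁ ∧ ∀ (a₀ θ₀ : T3 → ℝ) (u₀ : T3 → V3), Continuous a₀ → Continuous θ₀ →
      Continuous u₀ → (∀ x, 0 < a₀ x) → (∀ x, 0 < θ₀ x) →
      ∀ (T : ℝ) (ρ θ : ℝ → T3 → ℝ) (u : ℝ → T3 → V3), IsHardSphereEulerSolution σ T ρ u θ →
      ∀ Φ : (N : ℕ) → HardSphereFlow (Torus.geometry (Fin 3)) (hsDiameter σ N) (N + 1),
      TendstoHydroFieldsAt (fun N => localGibbsLaw σ a₀ u₀ θ₀ N (Φ N)) Φ ρ u θ 0 →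
      ∀ t ∈ Set.Ico 0 (min T τ₁),
      (∀ s ∈ Set.Icc 0 t, ∀ x, ρ s x * σ ^ 3 < η₀ ∧ ρ s x ≤ M ∧ θ s x ≤ M ∧ M⁻¹ ≤ θ s x ∧
        ‖u s x‖ ≤ M ∧ ∀ i j k : Fin 3, |Torus.partialDeriv i (ρ s) x| ≤ M ∧
        ‖Torus.partialDeriv i (u s) x‖ ≤ M ∧ |Torus.partialDeriv i (θ s) x| ≤ M ∧
        |Torus.partialDeriv i (Torus.partialDeriv j (ρ s)) x| ≤ M ∧
        ‖Torus.partialDeriv i (Torus.partialDeriv j (u s)) x‖ ≤ M ∧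
        |Torus.partialDeriv i (Torus.partialDeriv j (θ s)) x| ≤ M ∧
        |Torus.partialDeriv i (Torus.partialDeriv j (Torus.partialDeriv k (ρ s))) x| ≤ M ∧
        ‖Torus.partialDeriv i (Torus.partialDeriv j (Torus.partialDeriv k (u s))) x‖ ≤ M ∧
        |Torus.partialDeriv i (Torus.partialDeriv j (Torus.partialDeriv k (θ s))) x| ≤ M) →
      TendstoHydroFieldsAt (fun N => localGibbsLaw σ a₀ u₀ θ₀ N (Φ N)) Φ ρ u θ t := by
  sorry

/-- STUB (FORGETTING, dynamic half of BET 2; crux-sized, OPEN): LAW-LEVEL FORGETTING at a restart time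
`s₀` — ANY fresh local Gibbs gas whose time-`0` law of large numbers realises the time-`s₀` Euler data of
the true gas (activity `a`, velocity `u s₀`, temperature `θ s₀`) reproduces, on the window `w ≤ τ` and
under the guards, the forward macroscopic statistics of the TRUE law (bounded `1`-Lipschitz functionals
of each empirical field tested against a continuous `χ`). This is the card's `VelocityRefreshForgetting`
+ `CellRefreshForgetting` + `GlauberContraction` composed, i.e. propagation of local equilibrium in law;
it is the research bet of the line (together with BET 1 it carries exactly the burden of `G`). -/
theorem stub_forgetting :
    ∃ η₀ : ℝ, 0 < η₀ ∧ ∀ (a₀ θ₀ : T3 → ℝ) (u₀ : T3 → V3), Continuous a₀ → Continuous θ₀ →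
      Continuous u₀ → (∀ x, 0 < a₀ x) → (∀ x, 0 < θ₀ x) → ∃ σ₀ : ℝ, 0 < σ₀ ∧ ∀ σ : ℝ, 0 < σ →
      σ < σ₀ → ∀ M : ℝ, 0 < M → ∃ τ : ℝ, 0 < τ ∧ ∀ (T : ℝ) (ρ θ : ℝ → T3 → ℝ) (u : ℝ → T3 → V3),
      IsHardSphereEulerSolution σ T ρ u θ →
      ∀ Φ : (N : ℕ) → HardSphereFlow (Torus.geometry (Fin 3)) (hsDiameter σ N) (N + 1),
      ∀ s₀ ∈ Set.Ico 0 T,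
      (∀ s ∈ Set.Icc 0 s₀,
        TendstoHydroFieldsAt (fun N => localGibbsLaw σ a₀ u₀ θ₀ N (Φ N)) Φ ρ u θ s) →
      (∀ s ∈ Set.Icc 0 s₀, ∀ x, ρ s x * σ ^ 3 < η₀ ∧ ρ s x ≤ M ∧ θ s x ≤ M ∧ M⁻¹ ≤ θ s x ∧
        ‖u s x‖ ≤ M ∧ ∀ i j k : Fin 3, |Torus.partialDeriv i (ρ s) x| ≤ M ∧
        ‖Torus.partialDeriv i (u s) x‖ ≤ M ∧ |Torus.partialDeriv i (θ s) x| ≤ M ∧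
        |Torus.partialDeriv i (Torus.partialDeriv j (ρ s)) x| ≤ M ∧
        ‖Torus.partialDeriv i (Torus.partialDeriv j (u s)) x‖ ≤ M ∧
        |Torus.partialDeriv i (Torus.partialDeriv j (θ s)) x| ≤ M ∧
        |Torus.partialDeriv i (Torus.partialDeriv j (Torus.partialDeriv k (ρ s))) x| ≤ M ∧
        ‖Torus.partialDeriv i (Torus.partialDeriv j (Torus.partialDeriv k (u s))) x‖ ≤ M ∧
        |Torus.partialDeriv i (Torus.partialDeriv j (Torus.partialDeriv k (θ s))) x| ≤ M) →
      ∀ a : T3 → ℝ, Continuous a → (∀ x, 0 < a x) →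
        TendstoHydroFieldsAt (fun N => localGibbsLaw σ a (u s₀) (θ s₀) N (Φ N)) Φ
          (fun t => ρ (s₀ + t)) (fun t => u (s₀ + t)) (fun t => θ (s₀ + t)) 0 →
        ∀ w : ℝ, 0 ≤ w → w ≤ τ → s₀ + w < T →
        (∀ s ∈ Set.Icc 0 (s₀ + w), ∀ x, ρ s x * σ ^ 3 < η₀ ∧ ρ s x ≤ M ∧ θ s x ≤ M ∧ M⁻¹ ≤ θ s x ∧
        ‖u s x‖ ≤ M ∧ ∀ i j k : Fin 3, |Torus.partialDeriv i (ρ s) x| ≤ M ∧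
        ‖Torus.partialDeriv i (u s) x‖ ≤ M ∧ |Torus.partialDeriv i (θ s) x| ≤ M ∧
        |Torus.partialDeriv i (Torus.partialDeriv j (ρ s)) x| ≤ M ∧
        ‖Torus.partialDeriv i (Torus.partialDeriv j (u s)) x‖ ≤ M ∧
        |Torus.partialDeriv i (Torus.partialDeriv j (θ s)) x| ≤ M ∧
        |Torus.partialDeriv i (Torus.partialDeriv j (Torus.partialDeriv k (ρ s))) x| ≤ M ∧
        ‖Torus.partialDeriv i (Torus.partialDeriv j (Torus.partialDeriv k (u s))) x‖ ≤ M ∧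
        |Torus.partialDeriv i (Torus.partialDeriv j (Torus.partialDeriv k (θ s))) x| ≤ M) →
        ∀ χ : T3 → ℝ, Continuous χ →
          (∀ F : ℝ → ℝ, LipschitzWith 1 F → (∀ p, |F p| ≤ 1) →
            Tendsto (fun N => (∫ z, F (empiricalDensityField ((Φ N).flow (s₀ + w) z) χ)
                ∂(localGibbsLaw σ a₀ u₀ θ₀ N (Φ N))) -
              ∫ z, F (empiricalDensityField ((Φ N).flow w z) χ)
                ∂(localGibbsLaw σ a (u s₀) (θ s₀) N (Φ N))) atTop (nhds 0)) ∧
          (∀ F : V3 → ℝ, LipschitzWith 1 F → (∀ p, |F p| ≤ 1) →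
            Tendsto (fun N => (∫ z, F (empiricalMomentumField ((Φ N).flow (s₀ + w) z) χ)
                ∂(localGibbsLaw σ a₀ u₀ θ₀ N (Φ N))) -
              ∫ z, F (empiricalMomentumField ((Φ N).flow w z) χ)
                ∂(localGibbsLaw σ a (u s₀) (θ s₀) N (Φ N))) atTop (nhds 0)) ∧
          (∀ F : ℝ → ℝ, LipschitzWith 1 F → (∀ p, |F p| ≤ 1) →
            Tendsto (fun N => (∫ z, F (empiricalEnergyField ((Φ N).flow (s₀ + w) z) χ)
                ∂(localGibbsLaw σ a₀ u₀ θ₀ N (Φ N))) -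
              ∫ z, F (empiricalEnergyField ((Φ N).flow w z) χ)
                ∂(localGibbsLaw σ a (u s₀) (θ s₀) N (Φ N))) atTop (nhds 0)) := by
  sorry

-- CLOSED stubs, imported (same namespace, used below by name):
-- `stub_finiteSize` (p96553), `stub_solutionShift` (p98797), `stub_probTransfer` (p100354),
-- `stub_restartGlue` (p101649).

/-! ## Recombination of BET 2 from its halves (proved) -/

/-- Unit mass at a time where the law of large numbers holds: testing the LLN against `χ ≡ 1` (the
empirical density of `1` is `1`, the laws are probability measures for `σ ≤ 1/2`). -/
theorem integral_density_eq_one_of_lln {σ : ℝ} {a₀ θ₀ : T3 → ℝ} {u₀ : T3 → V3} (ha : Continuous a₀)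
    (hθ : Continuous θ₀) (hu : Continuous u₀) (ha0 : ∀ x, 0 < a₀ x) (hθ0 : ∀ x, 0 < θ₀ x)
    (hσ2 : σ ≤ 1 / 2) {ρ θ : ℝ → T3 → ℝ} {u : ℝ → T3 → V3}
    {Φ : (N : ℕ) → HardSphereFlow (Torus.geometry (Fin 3)) (hsDiameter σ N) (N + 1)} {s : ℝ}
    (h : TendstoHydroFieldsAt (fun N => localGibbsLaw σ a₀ u₀ θ₀ N (Φ N)) Φ ρ u θ s) :
    ∫ x, ρ s x = 1 := by
  by_contra hne
  set δ : ℝ := |1 - ∫ x, ρ s x| / 2 with hδ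
  have hδpos : 0 < δ := by
    have : (1 : ℝ) - ∫ x, ρ s x ≠ 0 := fun h0 => hne (by linarith)
    positivity
  have hlim := (h (fun _ => (1 : ℝ)) continuous_const δ hδpos).1
  have hset : ∀ N : ℕ, {z : Config (N + 1) (Fin 3) T3 |
      δ < |empiricalDensityField ((Φ N).flow s z) (fun _ => (1 : ℝ)) - ∫ x, (1 : ℝ) * ρ s x|} =
      Set.univ := by
    intro N
    refine Set.eq_univ_of_forall fun z => ?_
    simp only [Set.mem_setOf_eq, empiricalDensityField_one (Nat.succ_ne_zero N), one_mul]
    rw [hδ]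
    have hpos : 0 < |1 - ∫ x, ρ s x| := by positivity
    linarith
  have hone : ∀ N : ℕ, localGibbsLaw σ a₀ u₀ θ₀ N (Φ N) {z : Config (N + 1) (Fin 3) T3 |
      δ < |empiricalDensityField ((Φ N).flow s z) (fun _ => (1 : ℝ)) - ∫ x, (1 : ℝ) * ρ s x|} = 1 := by
    intro N
    haveI := isProbabilityMeasure_localGibbsLaw ha hθ hu ha0 hθ0 hσ2 N (Φ N)
    rw [hset N, measure_univ]
  have h1 : Tendsto (fun _ : ℕ => (1 : ENNReal)) atTop (nhds 0) := hlim.congr hone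
  exact zero_ne_one (tendsto_nhds_unique h1 tendsto_const_nhds)

/-- **REALISABILITY (static half of BET 2) — known mathematics, from the tree.** Every continuous positive
unit-mass density `r` in the dilute band `r σ³ ≤ η₁` (`0 < σ < 1/2`) is the time-`0` law-of-large-numbers density
of a FRESH local Gibbs hard-sphere gas with some continuous positive activity `a`, for any continuous velocity
`u'` and temperature `θ' > 0`, through every flow family: activity inversion
`EntropyClockDock.exists_activity_of_density` (`rhoLim (profileOf a) σ = r`, `SmallDensity (profileOf a) σ`;
Theorems/TwoClocksClampedWindowDockActivityInversion) + the fixed-`σ` local-equilibrium LLN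
`EntropyClockDock.tie_rhoLim_of_smallDensity` (Theorems/TwoClocksClampedWindowDockReferenceLLN). -/
theorem realisability :
    ∃ η₁ : ℝ, 0 < η₁ ∧ ∀ σ : ℝ, 0 < σ → σ < 1 / 2 →
      ∀ (r θ' : T3 → ℝ) (u' : T3 → V3), Continuous r → Continuous θ' → Continuous u' →
      (∀ x, 0 < r x) → (∀ x, 0 < θ' x) → (∫ x, r x) = 1 → (∀ x, r x * σ ^ 3 ≤ η₁) →
      ∃ a : T3 → ℝ, Continuous a ∧ (∀ x, 0 < a x) ∧
        ∀ Φ : (N : ℕ) → HardSphereFlow (Torus.geometry (Fin 3)) (hsDiameter σ N) (N + 1),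
          TendstoHydroFieldsAt (fun N => localGibbsLaw σ a u' θ' N (Φ N)) Φ
            (fun _ => r) (fun _ => u') (fun _ => θ') 0 := by
  obtain ⟨η₁, hη₁, hinv⟩ := EntropyClockDock.exists_activity_of_density
  refine ⟨η₁, hη₁, fun σ hσ hσ2 r θ' u' hr hθ' hu' hr0 hθ0 hmass hpack => ?_⟩
  have hσ3 : 0 < σ ^ 3 := pow_pos hσ 3
  have hsup : σ ^ 3 * (⨆ x, r x) ≤ η₁ := by
    have h1 : (⨆ x, r x) ≤ η₁ / σ ^ 3 := by
      refine ciSup_le fun x => ?_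
      rw [le_div_iff₀ hσ3]
      exact hpack x
    calc σ ^ 3 * (⨆ x, r x) ≤ σ ^ 3 * (η₁ / σ ^ 3) := mul_le_mul_of_nonneg_left h1 hσ3.le
      _ = η₁ := mul_div_cancel₀ _ hσ3.ne'
  obtain ⟨a, ha, ha0, -, hS, hlim⟩ := hinv σ hσ hσ2 r hr hr0 hmass hsup
  refine ⟨a, ha, ha0, fun Φ => ?_⟩
  have h := EntropyClockDock.tie_rhoLim_of_smallDensity ha hθ' hu' ha0 hθ0 hσ2.le hS Φ
  rwa [hlim] at h

/-- BET 2 (LAUNDERING IN LAW, verbatim the statement the landed glue `stub_restartGlue` consumes) from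
its static half REALISABILITY (`stub_activityInversion` + `stub_realisedLLN`: the time-`s₀` density
`ρ s₀` — continuous, positive, unit mass by the LLN at `s₀`, packing `< η₀` — is the LLN density of the
fresh local Gibbs gas with activity `g`, velocity `u s₀`, temperature `θ s₀`) and its dynamic half
FORGETTING (`stub_forgetting`, applied to that `g`). -/
theorem launderedRestart_of_stubs :
    ∃ η₀ : ℝ, 0 < η₀ ∧ ∀ (a₀ θ₀ : T3 → ℝ) (u₀ : T3 → V3), Continuous a₀ → Continuous θ₀ →
      Continuous u₀ → (∀ x, 0 < a₀ x) → (∀ x, 0 < θ₀ x) → ∃ σ₀ : ℝ, 0 < σ₀ ∧ ∀ σ : ℝ, 0 < σ →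
      σ < σ₀ → ∀ M : ℝ, 0 < M → ∃ τ : ℝ, 0 < τ ∧ ∀ (T : ℝ) (ρ θ : ℝ → T3 → ℝ) (u : ℝ → T3 → V3),
      IsHardSphereEulerSolution σ T ρ u θ →
      ∀ Φ : (N : ℕ) → HardSphereFlow (Torus.geometry (Fin 3)) (hsDiameter σ N) (N + 1),
      ∀ s₀ ∈ Set.Ico 0 T,
      (∀ s ∈ Set.Icc 0 s₀,
        TendstoHydroFieldsAt (fun N => localGibbsLaw σ a₀ u₀ θ₀ N (Φ N)) Φ ρ u θ s) →
      (∀ s ∈ Set.Icc 0 s₀, ∀ x, ρ s x * σ ^ 3 < η₀ ∧ ρ s x ≤ M ∧ θ s x ≤ M ∧ M⁻¹ ≤ θ s x ∧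
        ‖u s x‖ ≤ M ∧ ∀ i j k : Fin 3, |Torus.partialDeriv i (ρ s) x| ≤ M ∧
        ‖Torus.partialDeriv i (u s) x‖ ≤ M ∧ |Torus.partialDeriv i (θ s) x| ≤ M ∧
        |Torus.partialDeriv i (Torus.partialDeriv j (ρ s)) x| ≤ M ∧
        ‖Torus.partialDeriv i (Torus.partialDeriv j (u s)) x‖ ≤ M ∧
        |Torus.partialDeriv i (Torus.partialDeriv j (θ s)) x| ≤ M ∧
        |Torus.partialDeriv i (Torus.partialDeriv j (Torus.partialDeriv k (ρ s))) x| ≤ M ∧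
        ‖Torus.partialDeriv i (Torus.partialDeriv j (Torus.partialDeriv k (u s))) x‖ ≤ M ∧
        |Torus.partialDeriv i (Torus.partialDeriv j (Torus.partialDeriv k (θ s))) x| ≤ M) →
      ∃ a : T3 → ℝ, Continuous a ∧ (∀ x, 0 < a x) ∧
        TendstoHydroFieldsAt (fun N => localGibbsLaw σ a (u s₀) (θ s₀) N (Φ N)) Φ
          (fun t => ρ (s₀ + t)) (fun t => u (s₀ + t)) (fun t => θ (s₀ + t)) 0 ∧
        ∀ w : ℝ, 0 ≤ w → w ≤ τ → s₀ + w < T →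
        (∀ s ∈ Set.Icc 0 (s₀ + w), ∀ x, ρ s x * σ ^ 3 < η₀ ∧ ρ s x ≤ M ∧ θ s x ≤ M ∧ M⁻¹ ≤ θ s x ∧
        ‖u s x‖ ≤ M ∧ ∀ i j k : Fin 3, |Torus.partialDeriv i (ρ s) x| ≤ M ∧
        ‖Torus.partialDeriv i (u s) x‖ ≤ M ∧ |Torus.partialDeriv i (θ s) x| ≤ M ∧
        |Torus.partialDeriv i (Torus.partialDeriv j (ρ s)) x| ≤ M ∧
        ‖Torus.partialDeriv i (Torus.partialDeriv j (u s)) x‖ ≤ M ∧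
        |Torus.partialDeriv i (Torus.partialDeriv j (θ s)) x| ≤ M ∧
        |Torus.partialDeriv i (Torus.partialDeriv j (Torus.partialDeriv k (ρ s))) x| ≤ M ∧
        ‖Torus.partialDeriv i (Torus.partialDeriv j (Torus.partialDeriv k (u s))) x‖ ≤ M ∧
        |Torus.partialDeriv i (Torus.partialDeriv j (Torus.partialDeriv k (θ s))) x| ≤ M) →
        ∀ χ : T3 → ℝ, Continuous χ →
          (∀ F : ℝ → ℝ, LipschitzWith 1 F → (∀ p, |F p| ≤ 1) →
            Tendsto (fun N => (∫ z, F (empiricalDensityField ((Φ N).flow (s₀ + w) z) χ)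
                ∂(localGibbsLaw σ a₀ u₀ θ₀ N (Φ N))) -
              ∫ z, F (empiricalDensityField ((Φ N).flow w z) χ)
                ∂(localGibbsLaw σ a (u s₀) (θ s₀) N (Φ N))) atTop (nhds 0)) ∧
          (∀ F : V3 → ℝ, LipschitzWith 1 F → (∀ p, |F p| ≤ 1) →
            Tendsto (fun N => (∫ z, F (empiricalMomentumField ((Φ N).flow (s₀ + w) z) χ)
                ∂(localGibbsLaw σ a₀ u₀ θ₀ N (Φ N))) -
              ∫ z, F (empiricalMomentumField ((Φ N).flow w z) χ)
                ∂(localGibbsLaw σ a (u s₀) (θ s₀) N (Φ N))) atTop (nhds 0)) ∧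
          (∀ F : ℝ → ℝ, LipschitzWith 1 F → (∀ p, |F p| ≤ 1) →
            Tendsto (fun N => (∫ z, F (empiricalEnergyField ((Φ N).flow (s₀ + w) z) χ)
                ∂(localGibbsLaw σ a₀ u₀ θ₀ N (Φ N))) -
              ∫ z, F (empiricalEnergyField ((Φ N).flow w z) χ)
                ∂(localGibbsLaw σ a (u s₀) (θ s₀) N (Φ N))) atTop (nhds 0)) := by
  obtain ⟨η₁, hη₁, hR⟩ := realisability
  obtain ⟨ηF, hηF, hF⟩ := stub_forgetting
  refine ⟨min η₁ ηF, lt_min hη₁ hηF, fun a₀ θ₀ u₀ ha hθ hu ha0 hθ0 => ?_⟩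
  obtain ⟨σF, hσF, hF⟩ := hF a₀ θ₀ u₀ ha hθ hu ha0 hθ0
  refine ⟨min σF (1 / 2), lt_min hσF one_half_pos, fun σ hσ hσlt M hM => ?_⟩
  have hσF' : σ < σF := lt_of_lt_of_le hσlt (min_le_left _ _)
  have hσ2 : σ < 1 / 2 := lt_of_lt_of_le hσlt (min_le_right _ _)
  obtain ⟨τ, hτ, hF⟩ := hF σ hσ hσF' M hM
  refine ⟨τ, hτ, fun T ρ θ u hsol Φ s₀ hs₀ hprev hguard => ?_⟩
  -- the time-`s₀` data: continuous, positive, unit mass, dilute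
  have hρc : Continuous (ρ s₀) := (hsol.smooth_density.isSmooth_slice hs₀).continuous
  have huc : Continuous (u s₀) := (hsol.smooth_velocity.isSmooth_slice hs₀).continuous
  have hθc : Continuous (θ s₀) := (hsol.smooth_temperature.isSmooth_slice hs₀).continuous
  have hρ0 : ∀ x, 0 < ρ s₀ x := hsol.density_pos s₀ hs₀
  have hθ0' : ∀ x, 0 < θ s₀ x := hsol.temperature_pos s₀ hs₀
  have hmass : ∫ x, ρ s₀ x = 1 :=
    integral_density_eq_one_of_lln ha hθ hu ha0 hθ0 hσ2.le (hprev s₀ ⟨hs₀.1, le_rfl⟩)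
  have hpack₁ : ∀ x, ρ s₀ x * σ ^ 3 ≤ η₁ := fun x =>
    (hguard s₀ ⟨hs₀.1, le_rfl⟩ x).1.le.trans (min_le_left _ _)
  -- realisability: a fresh local Gibbs gas with the time-`s₀` data
  obtain ⟨g, hg, hg0, hlln⟩ := hR σ hσ hσ2 (ρ s₀) (θ s₀) (u s₀) hρc hθc huc hρ0 hθ0' hmass hpack₁
  have hfresh : TendstoHydroFieldsAt (fun N => localGibbsLaw σ g (u s₀) (θ s₀) N (Φ N)) Φ
      (fun t => ρ (s₀ + t)) (fun t => u (s₀ + t)) (fun t => θ (s₀ + t)) 0 := by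
    intro χ hχ δ hδ
    simpa only [add_zero] using hlln Φ χ hχ δ hδ
  refine ⟨g, hg, hg0, hfresh, fun w hw hwτ hwT hguardw => ?_⟩
  -- forgetting, with the guards weakened from `η₀` to `ηF`
  have hle : min η₁ ηF ≤ ηF := min_le_right _ _
  exact hF T ρ θ u hsol Φ s₀ hs₀ hprev
    (fun s hs x => ⟨lt_of_lt_of_le (hguard s hs x).1 hle, (hguard s hs x).2⟩) g hg hg0 hfresh w hw
    hwτ hwT (fun s hs x => ⟨lt_of_lt_of_le (hguardw s hs x).1 hle, (hguardw s hs x).2⟩)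

/-! ## Composition -/

/-- The restartable short-time limit along the true law, from the stubs. -/
theorem restartableHL_of_stubs :
    ∃ η₀ : ℝ, 0 < η₀ ∧ ∀ (a₀ θ₀ : T3 → ℝ) (u₀ : T3 → V3), Continuous a₀ → Continuous θ₀ →
      Continuous u₀ → (∀ x, 0 < a₀ x) → (∀ x, 0 < θ₀ x) → ∃ σ₀ : ℝ, 0 < σ₀ ∧ ∀ σ : ℝ, 0 < σ →
      σ < σ₀ → ∀ M : ℝ, 0 < M → ∃ τ₁ : ℝ, 0 < τ₁ ∧ ∀ (T : ℝ) (ρ θ : ℝ → T3 → ℝ) (u : ℝ → T3 → V3),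
      IsHardSphereEulerSolution σ T ρ u θ →
      ∀ Φ : (N : ℕ) → HardSphereFlow (Torus.geometry (Fin 3)) (hsDiameter σ N) (N + 1),
      ∀ s₀ ∈ Set.Ico 0 T,
      (∀ s ∈ Set.Icc 0 s₀,
        TendstoHydroFieldsAt (fun N => localGibbsLaw σ a₀ u₀ θ₀ N (Φ N)) Φ ρ u θ s) →
      ∀ t ∈ Set.Ico s₀ (min T (s₀ + τ₁)),
      (∀ s ∈ Set.Icc 0 t, ∀ x, ρ s x * σ ^ 3 < η₀ ∧ ρ s x ≤ M ∧ θ s x ≤ M ∧ M⁻¹ ≤ θ s x ∧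
        ‖u s x‖ ≤ M ∧ ∀ i j k : Fin 3, |Torus.partialDeriv i (ρ s) x| ≤ M ∧
        ‖Torus.partialDeriv i (u s) x‖ ≤ M ∧ |Torus.partialDeriv i (θ s) x| ≤ M ∧
        |Torus.partialDeriv i (Torus.partialDeriv j (ρ s)) x| ≤ M ∧
        ‖Torus.partialDeriv i (Torus.partialDeriv j (u s)) x‖ ≤ M ∧
        |Torus.partialDeriv i (Torus.partialDeriv j (θ s)) x| ≤ M ∧
        |Torus.partialDeriv i (Torus.partialDeriv j (Torus.partialDeriv k (ρ s))) x| ≤ M ∧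
        ‖Torus.partialDeriv i (Torus.partialDeriv j (Torus.partialDeriv k (u s))) x‖ ≤ M ∧
        |Torus.partialDeriv i (Torus.partialDeriv j (Torus.partialDeriv k (θ s))) x| ≤ M) →
      TendstoHydroFieldsAt (fun N => localGibbsLaw σ a₀ u₀ θ₀ N (Φ N)) Φ ρ u θ t :=
  stub_restartGlue stub_restartableS launderedRestart_of_stubs stub_solutionShift stub_probTransfer

/-- The packing-guarded conjunct `G` (consequent of the crux; body of stmt-AtomisticToContinuum-3093):
restart induction over the grid `k · τ₁(M(t)) / 2` along the given classical solution. -/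
theorem guardedConjunct_of_stubs :
    ∃ η₀ : ℝ, 0 < η₀ ∧ ∀ (a₀ θ₀ : T3 → ℝ) (u₀ : T3 → V3), Continuous a₀ → Continuous θ₀ →
      Continuous u₀ → (∀ x, 0 < a₀ x) → (∀ x, 0 < θ₀ x) → ∃ σ₀ : ℝ, 0 < σ₀ ∧ ∀ σ : ℝ, 0 < σ →
      σ < σ₀ → ∀ (T : ℝ) (ρ θ : ℝ → T3 → ℝ) (u : ℝ → T3 → V3), IsHardSphereEulerSolution σ T ρ u θ →
      (∀ t ∈ Set.Ico 0 T, ∀ x, ρ t x * σ ^ 3 < η₀) →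
      ∀ Φ : (N : ℕ) → HardSphereFlow (Torus.geometry (Fin 3)) (hsDiameter σ N) (N + 1),
      TendstoHydroFieldsAt (fun N => localGibbsLaw σ a₀ u₀ θ₀ N (Φ N)) Φ ρ u θ 0 →
      ∀ t ∈ Set.Ico 0 T, TendstoHydroFieldsAt (fun N => localGibbsLaw σ a₀ u₀ θ₀ N (Φ N)) Φ ρ u θ t := by
  obtain ⟨η₀, hη₀, hS⟩ := restartableHL_of_stubs
  refine ⟨η₀, hη₀, fun a₀ θ₀ u₀ ha hθ hu ha0 hθ0 => ?_⟩
  obtain ⟨σ₀, hσ₀, hS⟩ := hS a₀ θ₀ u₀ ha hθ hu ha0 hθ0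
  refine ⟨σ₀, hσ₀, fun σ hσ hσσ₀ T ρ θ u hsol hpack Φ h0 t ht => ?_⟩
  -- the guard level on `[0, t]` and the restart step
  obtain ⟨M, hM, hsize⟩ := stub_finiteSize σ T ρ θ u hsol t ht.2
  obtain ⟨τ₁, hτ₁, hstep⟩ := hS σ hσ hσσ₀ M hM
  -- full guards on `[0, s]` for every `s ≤ t`
  have hguard : ∀ s, s ≤ t → ∀ s' ∈ Set.Icc 0 s, ∀ x, ρ s' x * σ ^ 3 < η₀ ∧ ρ s' x ≤ M ∧
      θ s' x ≤ M ∧ M⁻¹ ≤ θ s' x ∧ ‖u s' x‖ ≤ M ∧ ∀ i j k : Fin 3,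
      |Torus.partialDeriv i (ρ s') x| ≤ M ∧ ‖Torus.partialDeriv i (u s') x‖ ≤ M ∧
      |Torus.partialDeriv i (θ s') x| ≤ M ∧
      |Torus.partialDeriv i (Torus.partialDeriv j (ρ s')) x| ≤ M ∧
      ‖Torus.partialDeriv i (Torus.partialDeriv j (u s')) x‖ ≤ M ∧
      |Torus.partialDeriv i (Torus.partialDeriv j (θ s')) x| ≤ M ∧
      |Torus.partialDeriv i (Torus.partialDeriv j (Torus.partialDeriv k (ρ s'))) x| ≤ M ∧
      ‖Torus.partialDeriv i (Torus.partialDeriv j (Torus.partialDeriv k (u s'))) x‖ ≤ M ∧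
      |Torus.partialDeriv i (Torus.partialDeriv j (Torus.partialDeriv k (θ s'))) x| ≤ M := by
    intro s hs s' hs' x
    have hs't : s' ∈ Set.Icc 0 t := ⟨hs'.1, hs'.2.trans hs⟩
    exact ⟨hpack s' ⟨hs'.1, lt_of_le_of_lt hs't.2 ht.2⟩ x, hsize s' hs't x⟩
  -- restart induction over the grid `n · (τ₁ / 2)`
  have key : ∀ n : ℕ, ∀ s ∈ Set.Icc 0 t, s ≤ n * (τ₁ / 2) →
      TendstoHydroFieldsAt (fun N => localGibbsLaw σ a₀ u₀ θ₀ N (Φ N)) Φ ρ u θ s := by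
    intro n
    induction n with
    | zero =>
      intro s hs hsn
      have hs0 : s = 0 := le_antisymm (by simpa using hsn) hs.1
      rw [hs0]
      exact h0
    | succ n ih =>
      intro s hs hsn
      by_cases hcase : s ≤ n * (τ₁ / 2)
      · exact ih s hs hcase
      · push Not at hcase
        set s₀ : ℝ := n * (τ₁ / 2) with hs₀def
        have hs₀nn : 0 ≤ s₀ := by positivity
        have hs₀s : s₀ < s := hcase
        have hs₀T : s₀ ∈ Set.Ico 0 T := ⟨hs₀nn, (hs₀s.trans_le hs.2).trans ht.2⟩
        have hprev : ∀ s' ∈ Set.Icc 0 s₀,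
            TendstoHydroFieldsAt (fun N => localGibbsLaw σ a₀ u₀ θ₀ N (Φ N)) Φ ρ u θ s' :=
          fun s' hs' => ih s' ⟨hs'.1, hs'.2.trans (hs₀s.le.trans hs.2)⟩ hs'.2
        have hsI : s ∈ Set.Ico s₀ (min T (s₀ + τ₁)) := by
          refine ⟨hs₀s.le, lt_min (hs.2.trans_lt ht.2) ?_⟩
          have h1 : s ≤ s₀ + τ₁ / 2 := by
            have : ((n + 1 : ℕ) : ℝ) * (τ₁ / 2) = s₀ + τ₁ / 2 := by push_cast; ring
            linarith [hsn, this]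
          linarith
        exact hstep T ρ θ u hsol Φ s₀ hs₀T hprev s hsI (hguard s hs.2)
  -- reach `t` in finitely many steps
  obtain ⟨n, hn⟩ := exists_nat_ge (t / (τ₁ / 2))
  refine key n t ⟨ht.1, le_rfl⟩ ?_
  have hτ2 : 0 < τ₁ / 2 := half_pos hτ₁
  rwa [div_le_iff₀ hτ2] at hn

/-- COMPOSITION: the crux `RestartPrinciple` BY NAME from the stubs (its antecedent `S` is not used;
the consequent is `guardedConjunct_of_stubs`). -/
theorem RestartPrinciple_of : RestartPrinciple := fun _ => guardedConjunct_of_stubs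

/-! ## Where the burden sits (no stubs involved; leads c1/c2; all of it now landed in p108006)

The consequent `G` of the crux is VERBATIM the packing-guarded conjunct `HydroLimitInBand` of the live
shared item stmt-AtomisticToContinuum-9133 (`Summit.AtomisticToContinuum.HydrodynamicLimit.Theses.GermanoSplitLES.HydroLimitInBand`;
the copy stmt-3093 is moot): `RestartPrinciple ↔ (S → GermanoSplitLES.HydroLimitInBand)` holds by `Iff.rfl`, so
`fun (h : GermanoSplitLES.HydroLimitInBand) (_ : S) => h : … → RestartPrinciple` closes the crux from that item in
one line (checked in the lead's folder, `work/Bridge.lean`, rc 0, axioms standard; not placed in this skeleton so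
that the registered composition stays `RestartPrinciple_of` above), and by `G → S` (p101123) nothing short of `G`
(or of `¬S`) closes it. Outcome of cycle 2: `blocked-on: stmt-AtomisticToContinuum-9133`. -/

end Summit.AtomisticToContinuum.HydrodynamicLimit.Theorems.RestartPrinciple

end
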